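import Literature.AlgebraicGeometry.AbelianSchemes.PELTupleSpreadStageOfStageDuals   -- ★ p848288 GSPREAD-CORE head under the stage-duals hypothesis (+ iso-base ∕ localised ∕ pointwise readings)
import Literature.AlgebraicGeometry.AbelianSchemes.RosatiSpreadStage                 -- ★ p847823∕p847854 Rosati transport ∕ descent ∕ base change
import Literature.AlgebraicGeometry.AbelianSchemes.QuasiInverseSpreadStage           -- ★ p847745 quasi-inverse to a finer stage ∕ base change
import Literature.AlgebraicGeometry.AbelianSchemes.TupleIsoPointCriteria             -- ★ `exists_iso_of_tupleRel_id`
import Literature.AlgebraicGeometry.AbelianSchemes.AbelianSchemeDualIsogenyHom       -- ★ `DualPair.isMonHom_dualIsogenyOver`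
import Literature.AlgebraicGeometry.AbelianSchemes.AbelianSchemeOverHomNoetherianAnyBase -- ★ `isCommMonObj_of_isLocallyNoetherian_base`
import HarnessLib

/-!
# GSPREAD-CORE⁺: the STAGE ROWS `rosati`, `polQuasiInv`, `comm` carried by the stage tuple (hole (H2) of the `stub_GSPREAD` assembly)

★ p848288 `exists_stage_pelTuple_of_generic_of_stageDuals` produces, from a PEL tuple `(A₁, ι₁, (Â₁, 𝒫₁), λ₁, φ₁)` over the generic base `P ⊗_A K`, a stage
`s`, a tuple `(𝒜, ι, (Â, 𝒫), λ, φ)` over `P ⊗ D(s)` and a six-clause pull-back relation along the cone leg.  The closer leaf `Lines/F0_P6a_PELSpread.lean`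
(socket `stub_GSPREAD`, letter `RecordESpreadCofinal`; LA4-p03 (g0) census `CENSUS-stubGSPREAD-assembly.v1` hole (H2)) needs THREE MORE ROWS of the stage
tuple that the head does not export: (H2a) ROSATI `ι(b′) ≫ λ = λ ≫ ι(b)^∨`, (H2b) a QUASI-INVERSE homomorphism `ν : Â → 𝒜` with `λ ≫ ν = [d]`, (H2c)
`IsCommMonObj 𝒜.X` — from the corresponding E-side data on `A₁` (Rosati of the witness; ★ `Polarization.exists_monHom_quasiInverse_of_hasType_of_charZero`).
This file (squad «L4», seat LA4-p01 (g0), DEAL #10 hole (H2)) derives them and re-exports the head WITH the rows: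
* §1 **`rosati_of_tupleRel_genOver`** — Rosati at the FLAT stage from Rosati of `A₁` and the six-clause relation along the cone leg: factor the relation
  through THE base change along the leg (★ `exists_tupleRel_baseChange_of_tupleRel_comp` with `m₀ := 𝟙`), read it as an isomorphism of group schemes
  (★ `exists_iso_of_tupleRel_id`), transport Rosati across it (★ `RingAction.rosati_iff_of_transport_clauses`) and descend along the schematically dominant
  leg (★ `RingAction.rosati_of_genOver`); **`isCommMonObj_stage`** — (H2c) over the locally Noetherian stage base.
* §2 **`exists_stage_quasiInverse_of_tupleRel_genOver`** — (H2b): the E-side `ν₁` conjugated to the generic base change of the stage tuple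
  (`ν := e^∨ ≫ ν₁ ≫ e`, `λ_K ≫ ν = [d]` by `e ≫ λ_K ≫ e^∨ = λ₁`) spreads to a FINER stage `σ : s′ ⟶ s` (★ `exists_stage_quasiInverse`).
* §3 (ED. 2) **`exists_stage_pelTuple_rows_of_generic_of_stageDuals`** — THE HEAD⁺: ★ head, §1, §2, then restriction of the whole tuple to `s′` (relation re-read
  along the leg at `s′` by ★ `exists_tupleRel_baseChange_of_tupleRel_comp` with `m₀ :=` the relative leg; Rosati by ★ `rosati_row_baseChange`; relative
  dimension ∕ flatness ∕ commutativity at `s′`).  Same binders as the ★ head plus `hros₁`, `d ν₁ hν₁`; same conclusion plus the three rows.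
HONEST LABEL: HC_CM is proved only modulo the 2 remaining named inputs (hLiu418 24832, h413 24833) until rung 0 closes; generic, count-neutral,
`--supports stmt-HodgeConjecture-24832`.

## References
* [MumfordFogartyKirwan1994] D. Mumford, J. Fogarty, F. Kirwan, *Geometric Invariant Theory*, 3rd ed. (1994), Ch. 7 §2 Def. 7.2 (p. 129), Def. 7.3 (p. 130), §3 Prop. 7.3.
* [MumfordAV1970] D. Mumford, *Abelian Varieties* (1970), §7 Thm. 4 (p. 72), §15 Thm. 1 (p. 143), §20 (Rosati involution).
* [RapoportSmithlingZhang2020Diagonal] M. Rapoport, B. Smithling, W. Zhang (2020), §3.2 (Rosati condition), §4.1 Thm. 4.1 (p. 17).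
* [Kottwitz1992] R. Kottwitz, *Points on some Shimura varieties over finite fields*, JAMS 5 (1992), §5 (pp. 389–391).
* [EGAIV3] A. Grothendieck, J. Dieudonné, *EGA IV₃* (1966), Thm. 8.8.2, 11.10.5.
-/

set_option autoImplicit false

noncomputable section

-- Mathlib's `Over`/pull-back API is stated across semireducible wrappers (as in the ★ `AbelianSchemes/*` files).
set_option backward.isDefEq.respectTransparency false

open CategoryTheory CategoryTheory.Limits AlgebraicGeometry MonoidalCategory
open Literature.AlgebraicGeometry.Limits Literature.AlgebraicGeometry.Limits.LocApprox
open Literature.AlgebraicGeometry.Limits.OverFac (facObjIso)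
open Literature.AlgebraicGeometry.Motives (SchemeOver specOver)

namespace Literature.AlgebraicGeometry.AbelianSchemes

namespace AbelianSchemeOver

section Rows

variable {A : Type} [CommRing A] [IsDomain A] (K : Type) [Field K] [Algebra A K] [IsFractionRing A K]
  {P : SchemeOver A} {s : Idx (nonZeroDivisors A)} [Flat (pullback.snd P.hom ((baseDiagram (nonZeroDivisors A)).obj s).hom)]
  [IsLocallyNoetherian (P ⊗ specOver A K).left] [IsReduced (P ⊗ specOver A K).left]
  {O : Type*} [CommRing O] {g N : ℕ}
  (A₁ : AbelianSchemeOver (P ⊗ specOver A K).left) (ρ₁ : RingAction O A₁) (D₁ : A₁.DualPair) (pol₁ : A₁.Polarization D₁)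
  (φ₁ : A₁.LevelStructure g N)
  (𝒜 : AbelianSchemeOver (P ⊗ (baseDiagram (nonZeroDivisors A)).obj s).left) (ρ : RingAction O 𝒜) (D : 𝒜.DualPair)
  (pol : 𝒜.Polarization D) (φ : 𝒜.LevelStructure g N) (G : A₁.X.left ⟶ 𝒜.X.left) (Ĝ : D₁.hat.X.left ⟶ D.hat.X.left)

/-! ### §1 (H2a) Rosati and (H2c) commutativity at the stage -/

omit [Flat (pullback.snd P.hom ((baseDiagram (nonZeroDivisors A)).obj s).hom)] [IsLocallyNoetherian (P ⊗ specOver A K).left]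
  [IsReduced (P ⊗ specOver A K).left] [IsDomain A] [IsFractionRing A K] in
/-- (H2c) **The stage family is commutative** (every abelian scheme over a locally Noetherian base is; ★ `isCommMonObj_of_isLocallyNoetherian_base`).
[cite: MumfordFogartyKirwan1994, Ch. 6 §1 Corollary 6.5 (p. 117)] -/
theorem isCommMonObj_stage [IsLocallyNoetherian (P ⊗ (baseDiagram (nonZeroDivisors A)).obj s).left] : IsCommMonObj 𝒜.X :=
  𝒜.isCommMonObj_of_isLocallyNoetherian_base

/-- (H2a) **ROSATI AT THE STAGE FROM ROSATI OF THE GENERIC WITNESS AND THE SIX-CLAUSE RELATION ALONG THE CONE LEG.**  If `(G, Ĝ)` exhibits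
`(A₁, ι₁, (Â₁, 𝒫₁), λ₁, φ₁)` as the pull-back of the stage tuple `(𝒜, ι, (Â, 𝒫), λ, φ)` along `P ⊗ Spec K → P ⊗ D(s)` (flat stage) and `ι₁(b′) ≫ λ₁ = λ₁ ≫ ι₁(b)^∨`
for all `(b, b′)` with `r b b′`, then `ι(b′) ≫ λ = λ ≫ ι(b)^∨` at the stage. [cite: RapoportSmithlingZhang2020Diagonal, §3.2 and §4.1 Thm. 4.1 (p. 17)]
[cite: MumfordFogartyKirwan1994, Ch. 7 §2 Definition 7.2 (p. 129) and Definition 7.3 (p. 130)] [cite: EGAIV3, 11.10.5] -/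
theorem rosati_of_tupleRel_genOver (r : O → O → Prop)
    (hros₁ : ∀ b b' : O, r b b' → haveI := ρ₁.isMonHom b; ρ₁.i b' ≫ pol₁.lam = pol₁.lam ≫ DualPair.dualIsogenyOver (ρ₁.i b) D₁ D₁)
    (hR : φ₁.IsBaseChangeVia φ (P ◁ (baseCone (nonZeroDivisors A) K).π.app s).left G ∧
      D₁.hat.IsBaseChangeVia D.hat (P ◁ (baseCone (nonZeroDivisors A) K).π.app s).left Ĝ ∧
      (∃ (wG : A₁.X.hom ≫ (P ◁ (baseCone (nonZeroDivisors A) K).π.app s).left = G ≫ 𝒜.X.hom)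
          (wĜ : D₁.hat.X.hom ≫ (P ◁ (baseCone (nonZeroDivisors A) K).π.app s).left = Ĝ ≫ D.hat.X.hom),
        Nonempty ((Scheme.Modules.pullback
          (pullback.map A₁.X.hom D₁.hat.X.hom 𝒜.X.hom D.hat.X.hom G Ĝ (P ◁ (baseCone (nonZeroDivisors A) K).π.app s).left wG wĜ)).obj
            D.P ≅ D₁.P)) ∧
      pol₁.lam.left ≫ Ĝ = G ≫ pol.lam.left ∧ ∀ a : O, (ρ₁.i a).left ≫ G = G ≫ (ρ.i a).left) :
    ∀ b b' : O, r b b' → haveI := ρ.isMonHom b; ρ.i b' ≫ pol.lam = pol.lam ≫ DualPair.dualIsogenyOver (ρ.i b) D D := by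
  intro b b' hbb
  haveI : IsReduced (P ⊗ ((Functor.const (Idx (nonZeroDivisors A))).obj (baseCone (nonZeroDivisors A) K).pt).obj s).left :=
    ‹IsReduced (P ⊗ specOver A K).left›
  haveI : IsLocallyNoetherian (P ⊗ ((Functor.const (Idx (nonZeroDivisors A))).obj (baseCone (nonZeroDivisors A) K).pt).obj s).left :=
    ‹IsLocallyNoetherian (P ⊗ specOver A K).left›
  -- factor the relation along the leg through THE base change along the leg: a relation along `𝟙`
  have hR' := tupleRel_congr_base (f' := 𝟙 _ ≫ (P ◁ (baseCone (nonZeroDivisors A) K).π.app s).left) (Category.id_comp _).symm hR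
  obtain ⟨G', Ĝ', -, -, hR₁⟩ := exists_tupleRel_baseChange_of_tupleRel_comp 𝒜 ρ D pol φ (P ◁ (baseCone (nonZeroDivisors A) K).π.app s).left (𝟙 _) hR'
  -- read it as an isomorphism of group schemes (★ the converse of Layer A)
  obtain ⟨e, he, hleft, -, -, -, -⟩ := exists_iso_of_tupleRel_id D₁ (D.baseChange (P ◁ (baseCone (nonZeroDivisors A) K).π.app s).left) pol₁.lam (pol.baseChange (P ◁ (baseCone (nonZeroDivisors A) K).π.app s).left).lam
    (pol.baseChange (P ◁ (baseCone (nonZeroDivisors A) K).π.app s).left).nonempty_unitHatSlice_iso φ₁ (φ.baseChange (P ◁ (baseCone (nonZeroDivisors A) K).π.app s).left) (fun a => ρ₁.i a) (fun a => baseChangeHom (ρ.i a) (P ◁ (baseCone (nonZeroDivisors A) K).π.app s).left) hR₁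
  haveI := he
  obtain ⟨-, -, ⟨wG, wĜ, hP⟩, hlam, hact⟩ := hR₁
  subst hleft
  -- transport Rosati across `(e, Ĝ′)` to the base change along the leg, then descend along the schematically dominant leg
  have key := (RingAction.rosati_iff_of_transport_clauses e (D.baseChange (P ◁ (baseCone (nonZeroDivisors A) K).π.app s).left) D₁ (ρ.baseChange (P ◁ (baseCone (nonZeroDivisors A) K).π.app s).left) ρ₁ Ĝ' wG wĜ hP
    (pol.baseChange (P ◁ (baseCone (nonZeroDivisors A) K).π.app s).left).lam pol₁.lam hlam hact b b').mpr (hros₁ b b' hbb)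
  exact RingAction.rosati_of_genOver K ρ D pol.lam b b' key


/-! ### §2 (H2b) the quasi-inverse on the generic base change, then at a finer stage -/

variable [QuasiCompact P.hom] [QuasiSeparated P.hom]

/-- (H2b) **A QUASI-INVERSE OF THE STAGE POLARISATION AT A FINER STAGE** from a quasi-inverse `ν₁` of `λ₁` (`λ₁ ≫ ν₁ = [d]`) and the six-clause relation:
`ν := e^∨ ≫ ν₁ ≫ e` on the generic base change (`e : A₁ ≅ 𝒜 ×_{P_s} (P ⊗ Spec K)` the relation read as a group isomorphism, `e ≫ λ_K ≫ e^∨ = λ₁`), then ★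
`exists_stage_quasiInverse`. [cite: MumfordAV1970, §7 Thm. 4 (p. 72); §15 Thm. 1 (p. 143)] [cite: EGAIV3, Thm. 8.8.2 (i) and 11.10.5] -/
theorem exists_stage_quasiInverse_of_tupleRel_genOver (d : ℕ) (ν₁ : D₁.hat.X ⟶ A₁.X) [IsMonHom ν₁] (hν₁ : pol₁.lam ≫ ν₁ = A₁.mulN d)
    (hR : φ₁.IsBaseChangeVia φ (P ◁ (baseCone (nonZeroDivisors A) K).π.app s).left G ∧
      D₁.hat.IsBaseChangeVia D.hat (P ◁ (baseCone (nonZeroDivisors A) K).π.app s).left Ĝ ∧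
      (∃ (wG : A₁.X.hom ≫ (P ◁ (baseCone (nonZeroDivisors A) K).π.app s).left = G ≫ 𝒜.X.hom)
          (wĜ : D₁.hat.X.hom ≫ (P ◁ (baseCone (nonZeroDivisors A) K).π.app s).left = Ĝ ≫ D.hat.X.hom),
        Nonempty ((Scheme.Modules.pullback
          (pullback.map A₁.X.hom D₁.hat.X.hom 𝒜.X.hom D.hat.X.hom G Ĝ (P ◁ (baseCone (nonZeroDivisors A) K).π.app s).left wG wĜ)).obj
            D.P ≅ D₁.P)) ∧
      pol₁.lam.left ≫ Ĝ = G ≫ pol.lam.left ∧ ∀ a : O, (ρ₁.i a).left ≫ G = G ≫ (ρ.i a).left) :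
    ∃ (s' : Idx (nonZeroDivisors A)) (σ : s' ⟶ s)
      (ν : (D.baseChange (stageOver (nonZeroDivisors A) P σ).hom).hat.X ⟶ (𝒜.baseChange (stageOver (nonZeroDivisors A) P σ).hom).X),
      IsMonHom ν ∧ (pol.baseChange (stageOver (nonZeroDivisors A) P σ).hom).lam ≫ ν = (𝒜.baseChange (stageOver (nonZeroDivisors A) P σ).hom).mulN d := by
  haveI : IsReduced (P ⊗ ((Functor.const (Idx (nonZeroDivisors A))).obj (baseCone (nonZeroDivisors A) K).pt).obj s).left :=
    ‹IsReduced (P ⊗ specOver A K).left›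
  haveI : IsLocallyNoetherian (P ⊗ ((Functor.const (Idx (nonZeroDivisors A))).obj (baseCone (nonZeroDivisors A) K).pt).obj s).left :=
    ‹IsLocallyNoetherian (P ⊗ specOver A K).left›
  have hR' := tupleRel_congr_base (f' := 𝟙 _ ≫ (P ◁ (baseCone (nonZeroDivisors A) K).π.app s).left) (Category.id_comp _).symm hR
  obtain ⟨G', Ĝ', -, -, hR₁⟩ := exists_tupleRel_baseChange_of_tupleRel_comp 𝒜 ρ D pol φ (P ◁ (baseCone (nonZeroDivisors A) K).π.app s).left (𝟙 _) hR'
  obtain ⟨e, he, -, -, hlamE, -, -⟩ := exists_iso_of_tupleRel_id D₁ (D.baseChange (P ◁ (baseCone (nonZeroDivisors A) K).π.app s).left) pol₁.lam (pol.baseChange (P ◁ (baseCone (nonZeroDivisors A) K).π.app s).left).lam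
    (pol.baseChange (P ◁ (baseCone (nonZeroDivisors A) K).π.app s).left).nonempty_unitHatSlice_iso φ₁ (φ.baseChange (P ◁ (baseCone (nonZeroDivisors A) K).π.app s).left) (fun a => ρ₁.i a) (fun a => baseChangeHom (ρ.i a) (P ◁ (baseCone (nonZeroDivisors A) K).π.app s).left) hR₁
  haveI := he
  haveI := pol.isMonHom
  haveI hdI : IsMonHom (DualPair.dualIsogenyOver e.hom D₁ (D.baseChange (P ◁ (baseCone (nonZeroDivisors A) K).π.app s).left)) :=
    DualPair.isMonHom_dualIsogenyOver e.hom D₁ (D.baseChange (P ◁ (baseCone (nonZeroDivisors A) K).π.app s).left) (pol.baseChange (P ◁ (baseCone (nonZeroDivisors A) K).π.app s).left).nonempty_unitHatSlice_iso pol₁.nonempty_unitHatSlice_iso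
  -- `ν := e^∨ ≫ ν₁ ≫ e` on the generic base change of the stage tuple
  let ν : (D.baseChange (P ◁ (baseCone (nonZeroDivisors A) K).π.app s).left).hat.X ⟶ (𝒜.baseChange (P ◁ (baseCone (nonZeroDivisors A) K).π.app s).left).X := DualPair.dualIsogenyOver e.hom D₁ (D.baseChange (P ◁ (baseCone (nonZeroDivisors A) K).π.app s).left) ≫ ν₁ ≫ e.hom
  haveI hν : IsMonHom ν := inferInstance
  have hcomp : baseChangeHom pol.lam (P ◁ (baseCone (nonZeroDivisors A) K).π.app s).left ≫ ν = (𝒜.baseChange (P ◁ (baseCone (nonZeroDivisors A) K).π.app s).left).mulN d := by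
    rw [← cancel_epi e.hom]
    change e.hom ≫ (pol.baseChange (P ◁ (baseCone (nonZeroDivisors A) K).π.app s).left).lam ≫ DualPair.dualIsogenyOver e.hom D₁ (D.baseChange (P ◁ (baseCone (nonZeroDivisors A) K).π.app s).left) ≫ ν₁ ≫ e.hom = _
    rw [← Category.assoc (pol.baseChange (P ◁ (baseCone (nonZeroDivisors A) K).π.app s).left).lam, ← Category.assoc e.hom, ← Category.assoc e.hom] 
    rw [show (e.hom ≫ (pol.baseChange (P ◁ (baseCone (nonZeroDivisors A) K).π.app s).left).lam) ≫ DualPair.dualIsogenyOver e.hom D₁ (D.baseChange (P ◁ (baseCone (nonZeroDivisors A) K).π.app s).left) = pol₁.lam by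
      rw [Category.assoc]; exact hlamE]
    rw [← Category.assoc, hν₁, mulN_def, mulN_def, MonObj.pow_comp, MonObj.comp_pow, Category.id_comp, Category.comp_id]
  exact (exists_stage_quasiInverse K 𝒜 D.hat pol.lam d ν hcomp).imp fun s' ⟨σ, νₛ, hmon, hid, _⟩ => ⟨σ, νₛ, hmon, hid⟩


end Rows

/-! ### §3 (ED. 2) THE HEAD⁺: GSPREAD-CORE under the stage-duals hypothesis WITH the three stage rows -/

section HeadRows

variable {A : Type} [CommRing A] [IsDomain A] [IsNoetherianRing A] (K : Type) [Field K] [CharZero K] [Algebra A K] [IsFractionRing A K]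
  {P : SchemeOver A} [QuasiCompact P.hom] [QuasiSeparated P.hom] [LocallyOfFinitePresentation P.hom] [IsSeparated P.hom]
  [∀ s : Idx (nonZeroDivisors A), IsLocallyNoetherian (P ⊗ (baseDiagram (nonZeroDivisors A)).obj s).left]
  [IsLocallyNoetherian (P ⊗ specOver A K).left] [IsReduced (P ⊗ specOver A K).left]

/-- **GSPREAD-CORE⁺ — THE STAGE TUPLE WITH ITS ROWS.**  As ★ `exists_stage_pelTuple_of_generic_of_stageDuals` (same binders), plus: the E-side Rosati row of
`(A₁, ι₁, (Â₁, 𝒫₁), λ₁)` for a side condition `r` (`hros₁`) and a quasi-inverse `ν₁` of `λ₁` (`λ₁ ≫ ν₁ = [d]`, `hν₁`).  THEN the stage tuple `(𝒜, ι, (Â, 𝒫), λ, φ)` over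
`P ⊗ D(s)` (relative dimension `g`, flat stage, six-clause relation along the cone leg — as in the ★ head) ALSO carries (H2c) `IsCommMonObj 𝒜.X`, (H2a) the Rosati row
`∀ b b′, r b b′ → ι(b′) ≫ λ = λ ≫ ι(b)^∨`, and (H2b) a homomorphism `ν : Â → 𝒜` with `λ ≫ ν = [d]`.  PROOF: ★ head at `s`; §1 at `s`; §2 gives `σ : s′ ⟶ s` and `ν` at
`s′`; the tuple is RESTRICTED to `s′` (★ `AbelianSchemeOver∕RingAction∕DualPair∕Polarization∕LevelStructure.baseChange`), its relation re-read along the leg at `s′`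
(★ `exists_tupleRel_baseChange_of_tupleRel_comp`, `m₀ :=` the relative leg), Rosati by ★ `rosati_row_baseChange`, relative dimension ∕ flatness ∕ commutativity at `s′`.
[cite: MumfordFogartyKirwan1994, Ch. 7 §2 Definition 7.2 (p. 129) and §3 Proposition 7.3 (pp. 133–134)] [cite: RapoportSmithlingZhang2020Diagonal, §3.2 and §4.1 Thm. 4.1 (p. 17)]
[cite: MumfordAV1970, §7 Thm. 4 (p. 72)] [cite: EGAIV3, Thm. 8.8.2 and 11.10.5] [cite: Kottwitz1992, §5 (pp. 389–391)] -/
theorem exists_stage_pelTuple_rows_of_generic_of_stageDuals (hP : IsProper (pullback.snd P.hom (specOver A K).hom))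
    {O : Type*} [CommRing O] {m : ℕ} (bs : Module.Basis (Fin m) ℤ O) {g N : ℕ} [NeZero N] (hN : IsUnit ((N : ℕ) : K))
    (A₁ : AbelianSchemeOver (P ⊗ specOver A K).left) (ρ₁ : RingAction O A₁) (D₁ : A₁.DualPair) (pol₁ : A₁.Polarization D₁)
    (φ₁ : A₁.LevelStructure g N) (hg : A₁.IsOfRelDim g)
    (hdual : ∀ (t : Idx (nonZeroDivisors A)) (𝒜ₜ : AbelianSchemeOver (P ⊗ (baseDiagram (nonZeroDivisors A)).obj t).left)
      (G : A₁.X.left ⟶ 𝒜ₜ.X.left), A₁.IsBaseChangeVia 𝒜ₜ (P ◁ (baseCone (nonZeroDivisors A) K).π.app t).left G →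
      ∃ (s : Idx (nonZeroDivisors A)) (σ : s ⟶ t), Nonempty (𝒜ₜ.baseChange (stageOver (nonZeroDivisors A) P σ).hom).DualPair)
    (r : O → O → Prop)
    (hros₁ : ∀ b b' : O, r b b' → haveI := ρ₁.isMonHom b; ρ₁.i b' ≫ pol₁.lam = pol₁.lam ≫ DualPair.dualIsogenyOver (ρ₁.i b) D₁ D₁)
    (d : ℕ) (ν₁ : D₁.hat.X ⟶ A₁.X) [IsMonHom ν₁] (hν₁ : pol₁.lam ≫ ν₁ = A₁.mulN d) :
    ∃ (s : Idx (nonZeroDivisors A)) (𝒜 : AbelianSchemeOver (P ⊗ (baseDiagram (nonZeroDivisors A)).obj s).left) (ρ : RingAction O 𝒜)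
      (D : 𝒜.DualPair) (pol : 𝒜.Polarization D) (φ : 𝒜.LevelStructure g N) (G : A₁.X.left ⟶ 𝒜.X.left) (Ĝ : D₁.hat.X.left ⟶ D.hat.X.left),
      𝒜.IsOfRelDim g ∧ Flat (pullback.snd P.hom ((baseDiagram (nonZeroDivisors A)).obj s).hom) ∧
      (φ₁.IsBaseChangeVia φ (P ◁ (baseCone (nonZeroDivisors A) K).π.app s).left G ∧
        D₁.hat.IsBaseChangeVia D.hat (P ◁ (baseCone (nonZeroDivisors A) K).π.app s).left Ĝ ∧
        (∃ (wG : A₁.X.hom ≫ (P ◁ (baseCone (nonZeroDivisors A) K).π.app s).left = G ≫ 𝒜.X.hom)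
            (wĜ : D₁.hat.X.hom ≫ (P ◁ (baseCone (nonZeroDivisors A) K).π.app s).left = Ĝ ≫ D.hat.X.hom),
          Nonempty ((Scheme.Modules.pullback
            (pullback.map A₁.X.hom D₁.hat.X.hom 𝒜.X.hom D.hat.X.hom G Ĝ (P ◁ (baseCone (nonZeroDivisors A) K).π.app s).left wG wĜ)).obj
              D.P ≅ D₁.P)) ∧
        pol₁.lam.left ≫ Ĝ = G ≫ pol.lam.left ∧ ∀ a : O, (ρ₁.i a).left ≫ G = G ≫ (ρ.i a).left) ∧
      IsCommMonObj 𝒜.X ∧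
      (∀ b b' : O, r b b' → haveI := ρ.isMonHom b; ρ.i b' ≫ pol.lam = pol.lam ≫ DualPair.dualIsogenyOver (ρ.i b) D D) ∧
      ∃ ν : D.hat.X ⟶ 𝒜.X, IsMonHom ν ∧ pol.lam ≫ ν = 𝒜.mulN d := by
  -- the ★ head at a stage `s`
  obtain ⟨s, 𝒜, ρ, D, pol, φ, G, Ĝ, hg', hfl, hR⟩ :=
    exists_stage_pelTuple_of_generic_of_stageDuals K hP bs hN A₁ ρ₁ D₁ pol₁ φ₁ hg hdual
  haveI := hfl
  -- (H2a) at `s`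
  have hros := rosati_of_tupleRel_genOver K A₁ ρ₁ D₁ pol₁ φ₁ 𝒜 ρ D pol φ G Ĝ r hros₁ hR
  -- (H2b) at a finer stage `σ : s′ ⟶ s`
  obtain ⟨s', σ, ν, hν, hνid⟩ := exists_stage_quasiInverse_of_tupleRel_genOver K A₁ ρ₁ D₁ pol₁ φ₁ 𝒜 ρ D pol φ G Ĝ d ν₁ hν₁ hR
  -- RESTRICT the tuple to `s′`: the relation re-read along the leg at `s′` into THE base change along `P ⊗ D(s′) → P ⊗ D(s)`
  have hbase : (P ◁ (baseCone (nonZeroDivisors A) K).π.app s).left =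
      (relLeg (nonZeroDivisors A) K P σ).left ≫ (stageOver (nonZeroDivisors A) P σ).hom :=
    (whiskerLeft_leg_left_comp_whiskerLeft_map_left (nonZeroDivisors A) K P σ).symm
  obtain ⟨G', Ĝ', -, -, hR'⟩ := exists_tupleRel_baseChange_of_tupleRel_comp 𝒜 ρ D pol φ (stageOver (nonZeroDivisors A) P σ).hom
    (relLeg (nonZeroDivisors A) K P σ).left (tupleRel_congr_base hbase hR)
  haveI hfl' : Flat (pullback.snd P.hom ((baseDiagram (nonZeroDivisors A)).obj s').hom) := flat_snd_baseDiagram_of_hom σ hfl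
  exact ⟨s', 𝒜.baseChange (stageOver (nonZeroDivisors A) P σ).hom, ρ.baseChange _, D.baseChange _, pol.baseChange _, φ.baseChange _, G', Ĝ',
    hg'.baseChange _, hfl', hR', isCommMonObj_stage (𝒜.baseChange (stageOver (nonZeroDivisors A) P σ).hom),
    RingAction.rosati_row_baseChange (stageOver (nonZeroDivisors A) P σ).hom ρ D pol.lam r hros, ν, hν, hνid⟩

end HeadRows

end AbelianSchemeOver

end Literature.AlgebraicGeometry.AbelianSchemes

end
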